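import Mathlib

/-!
# Transitive actions of the full transformation semigroup `𝒯ₙ`

[Ganyushkin–Mazorchuk 2009, §10.3: Lemma 10.3.2, Theorem 10.3.1, Corollary 10.3.3].  An action of
the monoid `𝒯(X)` (Mathlib's `Function.End X`) on a set `M` by transformations is a monoid
homomorphism `φ : Function.End X →* Function.End M`; it is *transitive* if for all `x, y ∈ M`
there is `α` with `φ(α)(x) = y`, *faithful* if `φ` is injective, and two actions are *similar*
if they are intertwined by a bijection.  The constant transformation `0_a` is `fun _ => a`.

* Lemma 10.3.2: for an action `ψ`, `ψ(0_a)(ψ(α) x) = ψ(0_a)(x)` (the kernel blocks of `ψ(0_a)`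
  are invariant) and `ψ(α)(ψ(0_a) y) = ψ(0_{α a}) y` (the union of the images of the `ψ(0_a)` is
  invariant) (`action_const_apply`, `action_apply_const`);
* Theorem 10.3.1: a transitive action of `𝒯(X)` (`X` nonempty) on a nonempty set `M` is either
  the trivial action on one point or similar to the natural action (`transitive_action`);
* Corollary 10.3.3: every transitive faithful action of `𝒯(X)` is similar to the natural action
  (`faithful_transitive_action`).

The book treats `X`, `M` finite and derives the non-faithful case from the description of the
congruences of `𝒯ₙ` (Theorem 6.3.10) and the faithful case from `Aut 𝒯ₙ ≅ 𝒮ₙ` (Theorem 7.1.3);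
the argument below is direct (a non-injective `φ` identifies all constants, and
`a ↦ φ(0_a)`'s constant value is the required equivariant map), so finiteness is not needed.

## References
* [GanyushkinMazorchuk2009] O. Ganyushkin, V. Mazorchuk, *Classical Finite Transformation
  Semigroups. An Introduction*, Algebra and Applications 9, Springer, 2009, §10.3.
-/

namespace Literature.Algebra.Semigroups.FullTransformation

open Function Set

variable {X M : Type*}

/-- Lemma 10.3.2 (i): for an action `ψ` of `𝒯(X)` and the left zero `0_a`,
`ψ(0_a)(ψ(α)(x)) = ψ(0_a α)(x) = ψ(0_a)(x)`: every block of the kernel partition of `ψ(0_a)` is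
invariant. [cite: GanyushkinMazorchuk2009, Lemma 10.3.2 (i)] -/
theorem action_const_apply (ψ : Function.End X →* Function.End M) (a : X) (α : Function.End X)
    (x : M) : ψ (fun _ => a) (ψ α x) = ψ (fun _ => a) x := by
  let c : Function.End X := fun _ => a
  show ψ c (ψ α x) = ψ c x
  have h : ψ (c * α) = ψ c * ψ α := map_mul ψ c α
  have hc : c * α = c := rfl
  rw [hc] at h
  exact (congrFun h x).symm

/-- Lemma 10.3.2 (ii): `ψ(α)(ψ(0_a)(y)) = ψ(α 0_a)(y) = ψ(0_{α(a)})(y)`: the union of the images of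
the `ψ(0_a)`, `a ∈ X`, is invariant. [cite: GanyushkinMazorchuk2009, Lemma 10.3.2 (ii)] -/
theorem action_apply_const (ψ : Function.End X →* Function.End M) (α : Function.End X) (a : X)
    (y : M) : ψ α (ψ (fun _ => a) y) = ψ (fun _ => α a) y := by
  let c : Function.End X := fun _ => a
  let c' : Function.End X := fun _ => α a
  show ψ α (ψ c y) = ψ c' y
  have h : ψ (α * c) = ψ α * ψ c := map_mul ψ α c
  have hc : α * c = c' := rfl
  rw [hc] at h
  exact (congrFun h y).symm

/-- For a transitive action, each `φ(0_a)` is a constant map (its kernel blocks are invariant,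
Lemma 10.3.2 (i)). [cite: GanyushkinMazorchuk2009, Theorem 10.3.1 (proof)] -/
theorem action_const_eq_const (φ : Function.End X →* Function.End M)
    (htrans : ∀ x y : M, ∃ α : Function.End X, φ α x = y) (a : X) (x y : M) :
    φ (fun _ => a) x = φ (fun _ => a) y := by
  obtain ⟨α, rfl⟩ := htrans x y
  exact (action_const_apply φ a α x).symm

/-- A non-faithful action of `𝒯(X)` identifies all constants: if `φ α = φ β` with `α ≠ β` then
`φ(0_c) = φ(0_d)` for all `c, d` (with `α x ≠ β x`: `0_c = σ 0_{αx} = σ α 0_x` and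
`0_d = σ 0_{βx} = σ β 0_x` for a `σ` with `σ(αx) = c`, `σ(βx) = d`).  In the book this is read off
the list of congruences of `𝒯ₙ` (Theorem 6.3.10). [cite: GanyushkinMazorchuk2009, Theorem 10.3.1 (proof)] -/
theorem action_const_eq_of_not_injective (φ : Function.End X →* Function.End M)
    (hφ : ¬ Injective φ) (c d : X) : φ (fun _ => c) = φ (fun _ => d) := by
  classical
  obtain ⟨α, β, hαβ, hne⟩ : ∃ α β, φ α = φ β ∧ α ≠ β := by
    simpa [Injective, not_forall] using hφ
  obtain ⟨x, hx⟩ : ∃ x, α x ≠ β x := by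
    by_contra h
    push Not at h
    exact hne (funext h)
  let σ : Function.End X := update (fun _ => c) (β x) d
  have hσa : σ (α x) = c := by simp [σ, hx]
  have hσb : σ (β x) = d := by simp [σ]
  let cc : Function.End X := fun _ => c
  let cd : Function.End X := fun _ => d
  let cx : Function.End X := fun _ => x
  have h1 : cc = σ * α * cx := by
    funext y; exact hσa.symm
  have h2 : cd = σ * β * cx := by
    funext y; exact hσb.symm
  show φ cc = φ cd
  rw [h1, h2, map_mul, map_mul, map_mul, map_mul, hαβ]

/-- Theorem 10.3.1: let `φ` be a transitive action of `𝒯(X)` (`X ≠ ∅`) on a nonempty set `M`.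
Then either `M` is a single point (the trivial action), or the action is similar to the natural
action of `𝒯(X)` on `X`: there is a bijection `f : X → M` with `f(α(a)) = φ(α)(f(a))`.
[cite: GanyushkinMazorchuk2009, Theorem 10.3.1] -/
theorem transitive_action [Nonempty X] [Nonempty M] (φ : Function.End X →* Function.End M)
    (htrans : ∀ x y : M, ∃ α : Function.End X, φ α x = y) :
    Subsingleton M ∨ ∃ f : X ≃ M, ∀ (α : Function.End X) (a : X), f (α a) = φ α (f a) := by
  inhabit M
  inhabit X
  -- `f(a)` = the constant value of `φ(0_a)`
  let f : X → M := fun a => φ (fun _ => a) default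
  have hf : ∀ (α : Function.End X) (a : X), f (α a) = φ α (f a) := fun α a =>
    (action_apply_const φ α a default).symm
  -- `f` is onto by transitivity (Lemma 10.3.2 (ii))
  have hsurj : Surjective f := by
    intro m
    obtain ⟨α, hα⟩ := htrans (f default) m
    exact ⟨α default, (hf α default).trans hα⟩
  by_cases hφ : Injective φ
  · -- faithful: `f` is injective, hence an equivariant bijection
    right
    have hinj : Injective f := by
      intro a b hab
      have : φ (fun _ => a) = φ (fun _ => b) := by
        funext x
        calc φ (fun _ => a) x = f a := action_const_eq_const φ htrans a x default
          _ = f b := hab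
          _ = φ (fun _ => b) x := action_const_eq_const φ htrans b default x
      have := congrFun (hφ this) default
      exact this
    exact ⟨Equiv.ofBijective f ⟨hinj, hsurj⟩, hf⟩
  · -- not faithful: all `φ(0_a)` coincide, so `M = f(X)` is a single point
    left
    refine ⟨fun m m' => ?_⟩
    obtain ⟨a, rfl⟩ := hsurj m
    obtain ⟨b, rfl⟩ := hsurj m'
    show φ (fun _ => a) default = φ (fun _ => b) default
    rw [action_const_eq_of_not_injective φ hφ a b]

/-- Corollary 10.3.3: every transitive and faithful action of `𝒯(X)` (`X ≠ ∅`, `M ≠ ∅`) is similar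
to the natural action. [cite: GanyushkinMazorchuk2009, Corollary 10.3.3] -/
theorem faithful_transitive_action [Nonempty X] [Nonempty M] (φ : Function.End X →* Function.End M)
    (hφ : Injective φ) (htrans : ∀ x y : M, ∃ α : Function.End X, φ α x = y) :
    ∃ f : X ≃ M, ∀ (α : Function.End X) (a : X), f (α a) = φ α (f a) := by
  rcases transitive_action φ htrans with h | h
  · -- `M` is a point; faithfulness forces `X` to be a point too, and any bijection works
    haveI := h
    have hX : Subsingleton X := by
      refine ⟨fun a b => ?_⟩
      have : φ (fun _ => a) = φ (fun _ => b) := funext fun m => Subsingleton.elim _ _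
      exact congrFun (hφ this) a
    inhabit X; inhabit M
    refine ⟨⟨fun _ => default, fun _ => default, fun a => Subsingleton.elim _ _,
      fun m => Subsingleton.elim _ _⟩, fun α a => Subsingleton.elim _ _⟩
  · exact h

end Literature.Algebra.Semigroups.FullTransformation
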